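import Summits.HubbardSuperconductivity.HubbardSuperconductivity.Theorems.NodalWardXYVisonPairCostDefs

/-!
# Vocabulary of the infrared window of line `Sketch` (log-determinant transfer) for the crux
# `NodalWardXY.VisonPairCost` (stmt-HubbardSuperconductivity-1266) — part II of the `Defs`

Companion of `Theorems/NodalWardXYVisonPairCostDefs.lean`.  The registered stub `stub_infraredWindow :
GaugeMirrorIdentity → InfraredWindow` of the checked skeleton `Cruxes/VisonPairCost/Lines/Sketch.lean` (cycle 2:
every other stub has landed) is RESHAPED by the lead into the chain

  `GaugeMirrorIdentity → TwoSidedLogDet → MirrorSetup → (MirrorSetup → ResolventBound) → MirrorReduction`,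
  `MirrorReduction → FreeResolventDecay → SymbolIntegralBounds → InfraredWindow`,

whose statements are named here (definitions + `Prop`s only; nothing is asserted):

* the gauge mirror of crux idea `gauge-mirror-logdet` made CONCRETE for the vison string: `colOf`/`rowOf` (torus
  coordinates of an orbital), `strA L R` (the `4R` string orbitals: columns `< R`, rows `0,1`), `mirB L R` (the mirror
  complement: columns `≥ R` in rows `0,1`, and the full far rows `⌊L/2⌋, ⌊L/2⌋+1`), `mirU L` (`−1` on the half torus
  rows `1..⌊L/2⌋`), `mirV = U N₀ U − N₀`, `projA`, `projB`, the free resolvent `freeG = (N₀ + it)⁻¹`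
  (`N₀ = visonNambu L μ Δ₀ 0`), the crossing blocks `mirX1 = P_A G P_B V P_B`, `mirX2 = P_B (UGU) P_A V P_A`, and the
  crossing Hilbert–Schmidt sum `crossS = Σ_{a ∈ A, b ∈ B} ‖G_t(a,b)‖²`;
* `TwoSidedLogDet` — abstract: `|log ‖det(1 + X₁X₂)‖| ≤ √(F₁F₂) + F₁F₂ (5 + 4 log K)` from a resolvent bound `K` and the
  Frobenius sums `Fᵢ = Σ ‖Xᵢ‖²` (Schur's inequality `Σ|λ|² ≤ ‖Y‖_F²` + `|log|1+y| − Re y| ≤ |y|²` for `|y| ≤ ½`);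
* `MirrorSetup` — `A ∩ B = ∅`, `V = P_A V P_A + P_B V P_B`, `N_R = N₀ + P_A V P_A` (`L ≥ 4`, `2R ≤ L`);
* `ResolventBound` — `‖v‖² ≤ (1 + c/t)⁴ ‖(1 + X₁X₂) v‖²` (Woodbury twice; `c = ‖V_A‖`);
* `MirrorReduction` — the pointwise consequence `|D_t| ≤ c·S(t) + c·S(t)²(1 + |log t|)`;
* `FreeResolventDecay` — periodic summation by parts in ONE momentum: `‖G_t(a,b)‖ ≤ Φ₁/(4 d_col)` and
  `≤ (π/4) Φ₂/d_col²` (and the row versions), with the grid-line symbol integrals `colPhi1/2`, `rowPhi1/2` of the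
  explicit free Nambu symbol `symb` (`N̂(k) = [[ξ, −Δ̂],[−Δ̂, −ξ]]`, `ξ = −2cos k₁ − 2cos k₂ − μ`,
  `Δ̂ = 2Δ₀(cos k₁ − cos k₂)`, `(N̂ + it)⁻¹ = (N̂ − it)/(ξ² + Δ̂² + t²)`);
* `SymbolIntegralBounds` — the one genuinely analytic input: `Φ₁(t) ≤ C(1 + |log t|)`, `Φ₂(t) ≤ C/t` for
  `t ∈ [1/L, t₀]`, uniformly in `L ≥ 4` (four conical nodes: `μ ∈ (−4,4)`, `Δ₀ > 0`);
* `IRAssemblyHyp` is just the conjunction shape consumed by the assembly stub.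
-/

noncomputable section

-- tree namespace Summit.HubbardSuperconductivity.HubbardSuperconductivity (D-0017)
set_option linter.dupNamespace false

namespace Summit.HubbardSuperconductivity.HubbardSuperconductivity.Theorems.VisonPairCost

open Literature.Probability.LatticeModels Literature.MathematicalPhysics.QuantumLattice
open Summit.HubbardSuperconductivity.HubbardSuperconductivity.Theses.NodalWardXY
open scoped Matrix

/-! ## The concrete gauge mirror for the vison string -/

section Mirror

variable (L : ℕ) [NeZero L]

/-- Column coordinate (direction `0`) of the site under an orbital of the fermionic torus. -/
def colOf (o : Orb (FermionTorus 2 L)) : ZMod L := FermionTorus.toTorusSite (ofLex o).1 0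

/-- Row coordinate (direction `1`) of the site under an orbital of the fermionic torus. -/
def rowOf (o : Orb (FermionTorus 2 L)) : ZMod L := FermionTorus.toTorusSite (ofLex o).1 1

/-- Torus distance on `ℤ/Lℤ`: `min((a − b).val, (b − a).val)`. -/
def zdist (a b : ZMod L) : ℕ := min (a - b).val (b - a).val

/-- Column distance of two orbitals (torus distance of their column coordinates). -/
def colDist (a b : Orb (FermionTorus 2 L)) : ℕ := zdist L (colOf L a) (colOf L b)

/-- Row distance of two orbitals. -/
def rowDist (a b : Orb (FermionTorus 2 L)) : ℕ := zdist L (rowOf L a) (rowOf L b)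

/-- The string orbitals `A`: both Nambu components over the `2R` sites `(a, 0)`, `(a, 1)`, `a < R` (the endpoints of
the `R` flipped vertical bonds of `visonNambu L μ Δ₀ R`). -/
def strA (R : ℕ) : Finset (Orb (FermionTorus 2 L)) :=
  Finset.univ.filter fun o => (colOf L o).val < R ∧ (rowOf L o = 0 ∨ rowOf L o = 1)

/-- The mirror complement `B`: orbitals over the sites `(a, 0)`, `(a, 1)` with `a ≥ R`, and over the two full far rows
`⌊L/2⌋`, `⌊L/2⌋ + 1` (disjoint from `A` exactly when `L ≥ 4`). -/
def mirB (R : ℕ) : Finset (Orb (FermionTorus 2 L)) :=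
  Finset.univ.filter fun o =>
    (R ≤ (colOf L o).val ∧ (rowOf L o = 0 ∨ rowOf L o = 1)) ∨
      (rowOf L o = ((L / 2 : ℕ) : ZMod L) ∨ rowOf L o = ((L / 2 + 1 : ℕ) : ZMod L))

/-- The half-torus sign: `−1` on the orbitals over the rows `1, …, ⌊L/2⌋`, `+1` elsewhere (a Z₂ gauge transformation
whose coboundary is the two bond-rows `0|1` and `⌊L/2⌋|⌊L/2⌋+1`). -/
def mirU : Matrix (Orb (FermionTorus 2 L)) (Orb (FermionTorus 2 L)) ℂ :=
  Matrix.diagonal fun o => if 1 ≤ (rowOf L o).val ∧ (rowOf L o).val ≤ L / 2 then (-1 : ℂ) else 1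

/-- The coboundary perturbation `V = U N₀ U − N₀` (`N₀ = visonNambu L μ Δ₀ 0`): `−2 N₀` on the two flipped bond-rows. -/
def mirV (μ Δ₀ : ℝ) : Matrix (Orb (FermionTorus 2 L)) (Orb (FermionTorus 2 L)) ℂ :=
  mirU L * visonNambu L μ Δ₀ 0 * mirU L - visonNambu L μ Δ₀ 0

/-- Coordinate projection onto the string orbitals `A`. -/
def projA (R : ℕ) : Matrix (Orb (FermionTorus 2 L)) (Orb (FermionTorus 2 L)) ℂ :=
  Matrix.diagonal fun o => if o ∈ strA L R then (1 : ℂ) else 0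

/-- Coordinate projection onto the mirror complement `B`. -/
def projB (R : ℕ) : Matrix (Orb (FermionTorus 2 L)) (Orb (FermionTorus 2 L)) ℂ :=
  Matrix.diagonal fun o => if o ∈ mirB L R then (1 : ℂ) else 0

/-- The FREE torus resolvent at imaginary energy, `G_t = (N₀ + it)⁻¹`, `N₀ = visonNambu L μ Δ₀ 0`. -/
def freeG (μ Δ₀ t : ℝ) : Matrix (Orb (FermionTorus 2 L)) (Orb (FermionTorus 2 L)) ℂ :=
  (visonNambu L μ Δ₀ 0 + ((t : ℂ) * Complex.I) • (1 : Matrix (Orb (FermionTorus 2 L)) (Orb (FermionTorus 2 L)) ℂ))⁻¹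

/-- First crossing block `X₁ = P_A G P_B V P_B` (free propagation from the complement cut into the string). -/
def mirX1 (μ Δ₀ : ℝ) (R : ℕ) (t : ℝ) : Matrix (Orb (FermionTorus 2 L)) (Orb (FermionTorus 2 L)) ℂ :=
  projA L R * freeG L μ Δ₀ t * projB L R * mirV L μ Δ₀ * projB L R

/-- Second crossing block `X₂ = P_B (U G U) P_A V P_A`. -/
def mirX2 (μ Δ₀ : ℝ) (R : ℕ) (t : ℝ) : Matrix (Orb (FermionTorus 2 L)) (Orb (FermionTorus 2 L)) ℂ :=
  projB L R * (mirU L * freeG L μ Δ₀ t * mirU L) * projA L R * mirV L μ Δ₀ * projA L R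

/-- The crossing Hilbert–Schmidt sum `S(t) = Σ_{a ∈ A} Σ_{b ∈ B} ‖G_t(a,b)‖²` of the free resolvent across the cut. -/
def crossS (μ Δ₀ : ℝ) (R : ℕ) (t : ℝ) : ℝ :=
  ∑ a ∈ strA L R, ∑ b ∈ mirB L R, ‖freeG L μ Δ₀ t a b‖ ^ 2

end Mirror

/-! ## The free Nambu symbol and its grid-line integrals -/

/-- Band function `ξ(k) = −2cos k₁ − 2cos k₂ − μ`. -/
def xiS (μ k₁ k₂ : ℝ) : ℝ := -2 * Real.cos k₁ - 2 * Real.cos k₂ - μ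

/-- `d_{x²−y²}` gap function `Δ̂(k) = 2Δ₀(cos k₁ − cos k₂)`. -/
def gapS (Δ₀ k₁ k₂ : ℝ) : ℝ := 2 * Δ₀ * (Real.cos k₁ - Real.cos k₂)

/-- Entries of the free resolvent symbol `(N̂(k) + it)⁻¹ = (N̂(k) − it)/(ξ² + Δ̂² + t²)`, `N̂ = [[ξ, −Δ̂],[−Δ̂, −ξ]]`
(index `0` = particle = spin-`↑` orbital, `1` = hole = spin-`↓` orbital after the partial particle–hole transformation). -/
def symb (μ Δ₀ t k₁ k₂ : ℝ) (σ σ' : Fin 2) : ℂ :=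
  (((xiS μ k₁ k₂) ^ 2 + (gapS Δ₀ k₁ k₂) ^ 2 + t ^ 2)⁻¹ : ℝ) *
    (if σ = 0 then (if σ' = 0 then ((xiS μ k₁ k₂ : ℂ) - (t : ℂ) * Complex.I) else (-(gapS Δ₀ k₁ k₂) : ℂ))
      else (if σ' = 0 then (-(gapS Δ₀ k₁ k₂) : ℂ) else (-(xiS μ k₁ k₂ : ℂ) - (t : ℂ) * Complex.I)))

/-- `Φ₁` in the column direction: `(1/L) Σ_{j < L} Σ_{σσ'} ∫₀^{2π} ‖∂_{k₁} symb(k₁, 2πj/L)_{σσ'}‖ dk₁`. -/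
def colPhi1 (L : ℕ) (μ Δ₀ t : ℝ) : ℝ :=
  (1 / (L : ℝ)) * ∑ j : Fin L, ∑ σ : Fin 2, ∑ σ' : Fin 2,
    ∫ k in (0 : ℝ)..(2 * Real.pi), ‖deriv (fun s => symb μ Δ₀ t s (2 * Real.pi * (j : ℝ) / L) σ σ') k‖

/-- `Φ₂` in the column direction: the same with the second `k₁`-derivative. -/
def colPhi2 (L : ℕ) (μ Δ₀ t : ℝ) : ℝ :=
  (1 / (L : ℝ)) * ∑ j : Fin L, ∑ σ : Fin 2, ∑ σ' : Fin 2,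
    ∫ k in (0 : ℝ)..(2 * Real.pi), ‖iteratedDeriv 2 (fun s => symb μ Δ₀ t s (2 * Real.pi * (j : ℝ) / L) σ σ') k‖

/-- `Φ₁` in the row direction (derivative in `k₂`, grid sum over `k₁`). -/
def rowPhi1 (L : ℕ) (μ Δ₀ t : ℝ) : ℝ :=
  (1 / (L : ℝ)) * ∑ j : Fin L, ∑ σ : Fin 2, ∑ σ' : Fin 2,
    ∫ k in (0 : ℝ)..(2 * Real.pi), ‖deriv (fun s => symb μ Δ₀ t (2 * Real.pi * (j : ℝ) / L) s σ σ') k‖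

/-- `Φ₂` in the row direction. -/
def rowPhi2 (L : ℕ) (μ Δ₀ t : ℝ) : ℝ :=
  (1 / (L : ℝ)) * ∑ j : Fin L, ∑ σ : Fin 2, ∑ σ' : Fin 2,
    ∫ k in (0 : ℝ)..(2 * Real.pi), ‖iteratedDeriv 2 (fun s => symb μ Δ₀ t (2 * Real.pi * (j : ℝ) / L) s σ σ') k‖

/-! ## The statements of the infrared chain -/

/-- (IR-1) **Two-sided log-determinant estimate** (abstract, finite-dimensional): if `‖v‖² ≤ K² ‖(1 + X₁X₂)v‖²` for all
`v` (so `1 + X₁X₂` is invertible with inverse bounded by `K ≥ 1`) then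
`|log ‖det(1 + X₁X₂)‖| ≤ √(F₁F₂) + F₁F₂·(5 + 4 log K)`, `Fᵢ = Σ_{jl} ‖Xᵢ(j,l)‖²`
(Schur: `Σ|λ|² ≤ ‖X₁X₂‖_F² ≤ F₁F₂`; `|Tr(X₁X₂)| ≤ √(F₁F₂)`; `|log|1+y| − Re y| ≤ |y|²` for `|y| ≤ ½`; the `≤ 4F₁F₂`
eigenvalues with `|y| > ½` each contribute at most `log K + 2|y|`). -/
def TwoSidedLogDet : Prop :=
  ∀ (n : Type) [Fintype n] [DecidableEq n] (X₁ X₂ : Matrix n n ℂ) (K : ℝ), 1 ≤ K →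
    (∀ v : n → ℂ, (star v ⬝ᵥ v).re ≤ K ^ 2 * (star ((1 + X₁ * X₂) *ᵥ v) ⬝ᵥ ((1 + X₁ * X₂) *ᵥ v)).re) →
      |Real.log ‖(1 + X₁ * X₂).det‖| ≤
        Real.sqrt ((∑ i, ∑ j, ‖X₁ i j‖ ^ 2) * (∑ i, ∑ j, ‖X₂ i j‖ ^ 2)) +
          (∑ i, ∑ j, ‖X₁ i j‖ ^ 2) * (∑ i, ∑ j, ‖X₂ i j‖ ^ 2) * (5 + 4 * Real.log K)

/-- (IR-2) **Mirror set-up** for the vison string (`L ≥ 4`, `2R ≤ L`): `A` and `B` are disjoint, the coboundary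
perturbation splits as `V = P_A V P_A + P_B V P_B`, and the string is its `A`-part: `N_R = N₀ + P_A V P_A`. -/
def MirrorSetup : Prop :=
  ∀ (L : ℕ) [NeZero L], 4 ≤ L → ∀ (μ Δ₀ : ℝ) (R : ℕ), 2 * R ≤ L →
    Disjoint (strA L R) (mirB L R) ∧
      mirV L μ Δ₀ = projA L R * mirV L μ Δ₀ * projA L R + projB L R * mirV L μ Δ₀ * projB L R ∧
        visonNambu L μ Δ₀ R = visonNambu L μ Δ₀ 0 + projA L R * mirV L μ Δ₀ * projA L R

/-- (IR-3) **Resolvent bound** for `1 + X₁X₂` (`= 1 − Y_t`): `‖v‖² ≤ (2 + c/t)⁴ ‖(1 + X₁X₂) v‖²` with `c = c(μ,Δ₀)`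
(`(1 + X₁X₂)⁻¹ = (1 − P_A) + P_A (1 + M)⁻¹ P_A`, `M = G V_B G' V_A`, `(1 + M)⁻¹ = (1 + G_B V_A)(1 − G_R V_A)`, and
resolvents of Hermitian matrices at `it` have norm `≤ 1/t`). -/
def ResolventBound : Prop :=
  ∀ (μ Δ₀ : ℝ), ∃ c : ℝ, 0 ≤ c ∧ ∀ (L : ℕ) [NeZero L], 4 ≤ L → ∀ R : ℕ, 2 * R ≤ L → ∀ t : ℝ, 0 < t →
    ∀ v : Orb (FermionTorus 2 L) → ℂ,
      (star v ⬝ᵥ v).re ≤ (2 + c / t) ^ 4 *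
        (star ((1 + mirX1 L μ Δ₀ R t * mirX2 L μ Δ₀ R t) *ᵥ v) ⬝ᵥ
          ((1 + mirX1 L μ Δ₀ R t * mirX2 L μ Δ₀ R t) *ᵥ v)).re

/-- (IR-4) **Mirror reduction** (pointwise in `t`): `|D_t| ≤ c·S(t) + c·S(t)²·(1 + |log t|)` for all `t > 0`,
`L ≥ 4`, `2R ≤ L`, with `S = crossS` the FREE crossing Hilbert–Schmidt sum and `c = c(μ,Δ₀)`. -/
def MirrorReduction : Prop :=
  ∀ (μ Δ₀ : ℝ), ∃ c : ℝ, 0 ≤ c ∧ ∀ (L : ℕ) [NeZero L], 4 ≤ L → ∀ R : ℕ, 2 * R ≤ L → ∀ t : ℝ, 0 < t →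
    |logDetKernel (visonNambu L μ Δ₀ R) (visonNambu L μ Δ₀ 0) t| ≤
      c * crossS L μ Δ₀ R t + c * crossS L μ Δ₀ R t ^ 2 * (1 + |Real.log t|)

/-- (IR-5) **Free resolvent decay by periodic summation by parts** (one momentum at a time, exact Fourier
representation of `freeG` by the symbol `symb`): for `t > 0` and orbitals at column distance `d ≥ 1`,
`‖G_t(a,b)‖ ≤ Φ₁ᶜ/(4d)` and `‖G_t(a,b)‖ ≤ (π/4) Φ₂ᶜ/d²`; likewise in the row direction. -/
def FreeResolventDecay : Prop :=
  ∀ (L : ℕ) [NeZero L], 4 ≤ L → ∀ (μ Δ₀ t : ℝ), 0 < t → ∀ a b : Orb (FermionTorus 2 L),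
    (1 ≤ colDist L a b →
      ‖freeG L μ Δ₀ t a b‖ ≤ colPhi1 L μ Δ₀ t / (4 * (colDist L a b : ℝ)) ∧
        ‖freeG L μ Δ₀ t a b‖ ≤ Real.pi / 4 * colPhi2 L μ Δ₀ t / ((colDist L a b : ℝ) ^ 2)) ∧
    (1 ≤ rowDist L a b →
      ‖freeG L μ Δ₀ t a b‖ ≤ rowPhi1 L μ Δ₀ t / (4 * (rowDist L a b : ℝ)) ∧
        ‖freeG L μ Δ₀ t a b‖ ≤ Real.pi / 4 * rowPhi2 L μ Δ₀ t / ((rowDist L a b : ℝ) ^ 2))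

/-- (IR-6) **Symbol integral bounds** (the nodal analysis; `μ ∈ (−4,4)`, `Δ₀ > 0` enter only here): for
`t ∈ [1/L, t₀]`, uniformly in `L ≥ 4`, `Φ₁ ≤ C(1 + |log t|)` and `Φ₂ ≤ C/t` in both directions. -/
def SymbolIntegralBounds : Prop :=
  ∀ μ : ℝ, μ ∈ Set.Ioo (-4 : ℝ) 4 → μ ≠ 0 → ∀ Δ₀ : ℝ, 0 < Δ₀ → ∀ t₀ : ℝ, 1 ≤ t₀ → ∃ C : ℝ, 0 ≤ C ∧
    ∀ (L : ℕ) [NeZero L], 4 ≤ L → ∀ t : ℝ, 1 / (L : ℝ) ≤ t → t ≤ t₀ →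
      colPhi1 L μ Δ₀ t ≤ C * (1 + |Real.log t|) ∧ colPhi2 L μ Δ₀ t ≤ C / t ∧
        rowPhi1 L μ Δ₀ t ≤ C * (1 + |Real.log t|) ∧ rowPhi2 L μ Δ₀ t ≤ C / t

/-! ## One registered piece of the mirror set-up, proved here -/

/-- The string orbitals and the mirror complement are disjoint for `L ≥ 4` (the rows `0, 1` of the string and the far
rows `⌊L/2⌋, ⌊L/2⌋+1` of the complement are four distinct rows). Registered stub of the line; first conjunct of
`MirrorSetup`. -/
theorem strA_disjoint_mirB : ∀ (L : ℕ) [NeZero L], 4 ≤ L → ∀ R : ℕ, Disjoint (strA L R) (mirB L R) := by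
  intro L _ hL R
  rw [Finset.disjoint_left]
  intro o hA hB
  simp only [strA, mirB, Finset.mem_filter, Finset.mem_univ, true_and] at hA hB
  obtain ⟨hcol, hrow⟩ := hA
  -- the four rows 0, 1, ⌊L/2⌋, ⌊L/2⌋+1 are distinct residues mod L
  have h2 : 2 ≤ L / 2 := by omega
  have hlt : L / 2 + 1 < L := by omega
  have hv0 : ((L / 2 : ℕ) : ZMod L).val = L / 2 := ZMod.val_natCast_of_lt (by omega)
  have hv1 : ((L / 2 + 1 : ℕ) : ZMod L).val = L / 2 + 1 := ZMod.val_natCast_of_lt hlt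
  have hval0 : (0 : ZMod L).val = 0 := ZMod.val_zero
  have hval1 : (1 : ZMod L).val = 1 := by
    haveI : Fact (1 < L) := ⟨by omega⟩
    exact ZMod.val_one L
  rcases hB with ⟨hcol', _⟩ | hfar
  · exact absurd hcol (not_lt.mpr hcol')
  · rcases hrow with h | h <;> rcases hfar with h' | h' <;>
      · have := congrArg ZMod.val (h.symm.trans h')
        simp only [hval0, hval1, hv0, hv1] at this
        omega

end Summit.HubbardSuperconductivity.HubbardSuperconductivity.Theorems.VisonPairCost

end
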